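import Mathlib.Analysis.SpecialFunctions.SmoothTransition
import Mathlib.Analysis.Calculus.Deriv.MeanValue
import Mathlib.Analysis.InnerProductSpace.PiL2
import Mathlib.Topology.Homotopy.Basic

/-!
# Helper `helper_modelHandlebody_localHomology_finite` of stub `stub_friendsH2` — part 2: calculus tools
(item stmt-SmoothPoincare4-16128, route route-SmoothPoincare4-DottedCircleRasmussen)

Elementary tools for the gradient-flow deformation of `B(0, R + 3) ∖ D_k` (part 3):

* `FriendsH2.flow_dichotomy` — for a flow `θ` of a field `W` whose zeros are fixed points, every
  orbit is either stationary (at a zero) or avoids the zero set of `W` (group law);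
* `FriendsH2.lt_of_hasDerivAt_of_band` — a function with nonnegative derivative, at least `m > 0`
  while its value lies in `[a, b]`, starting above `a`, exceeds `b` at every time `T ≥ (b - a)/m`
  (Milnor, *Morse theory* (1963), proof of Thm. 3.1: "`t ↦ f(φ_t(q))` has derivative `1` as long as
  it lies between `a` and `b`");
* `FriendsH2.cutoff_*` — a smooth plateau function `φ` (`= 1` on `[1, 1 + ε]`, `> 0` exactly on
  `(1 - ε, 1 + 2ε)`, values in `[0, 1]`) built from Mathlib's `Real.smoothTransition`;
* `FriendsH2.squeeze_*` — the radial squeeze `S_λ` of a normed space (identity on the ball of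
  radius `c`, moving the shell `c ≤ ‖y‖` radially inwards), continuous in `(λ, y)`.

Everything is proved; no definitions (the maps are written as explicit lambdas), no named facts,
no `sorry`.

## References

* J. Milnor, *Morse theory*, Ann. of Math. Studies 51 (1963), Thm. 3.1 and its proof. [Milnor1963]
-/

-- the prescribed namespace `Summit.<P>.<Sub>.…` duplicates `SmoothPoincare4` (P = Sub)
set_option linter.dupNamespace false
set_option linter.style.longLine false

noncomputable section

open scoped ContDiff
open Set Function Metric Topology

namespace Summit.SmoothPoincare4.SmoothPoincare4.Theorems.DcrGap.MkFriends

namespace FriendsH2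

/-! ## Orbits of a flow: stationary or off the zero set -/

/-- **Every orbit of a flow is stationary or avoids the zeros of the field** (zeros are fixed
points; group law). [folklore] -/
theorem flow_dichotomy {E : Type*} [Zero E] {θ : ℝ × E → E} {W : E → E} (h0 : ∀ x, θ (0, x) = x)
    (hadd : ∀ t s x, θ (t, θ (s, x)) = θ (t + s, x)) (hfix : ∀ x, W x = 0 → ∀ t, θ (t, x) = x)
    (x : E) :
    (W x = 0 ∧ ∀ t, θ (t, x) = x) ∨ (∀ t, W (θ (t, x)) ≠ 0) := by
  by_cases h : ∃ t, W (θ (t, x)) = 0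
  · obtain ⟨t, ht⟩ := h
    left
    have hy : ∀ s, θ (s, θ (t, x)) = θ (t, x) := hfix _ ht
    have hx : θ (t, x) = x := by
      have h1 := hy (-t)
      rw [hadd, neg_add_cancel, h0] at h1
      exact h1.symm
    refine ⟨hx ▸ ht, fun s => ?_⟩
    have h2 := hy s
    rwa [hx] at h2
  · right
    push Not at h
    exact h

/-! ## Growth through a band -/

/-- **Passing through a band at positive speed** (Milnor 1963, proof of Thm. 3.1): if `g' ≥ 0`
everywhere, `g' ≥ m > 0` whenever `a ≤ g ≤ b`, and `g 0 > a`, then `g T > b` for every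
`T ≥ (b - a)/m`, `T ≥ 0`. [cite: Milnor1963, proof of Thm. 3.1] -/
theorem lt_of_hasDerivAt_of_band {g g' : ℝ → ℝ} (hg : ∀ t, HasDerivAt g (g' t) t)
    (hnn : ∀ t, 0 ≤ g' t) {a b m T : ℝ} (hm : 0 < m) (ha : a < g 0)
    (hband : ∀ t, a ≤ g t → g t ≤ b → m ≤ g' t) (hT : (b - a) / m ≤ T) (hT0 : 0 ≤ T) :
    b < g T := by
  have hdiff : Differentiable ℝ g := fun t => (hg t).differentiableAt
  have hderiv : ∀ t, deriv g t = g' t := fun t => (hg t).deriv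
  have hmono : Monotone g := monotone_of_deriv_nonneg hdiff fun t => by rw [hderiv]; exact hnn t
  by_contra hle
  push Not at hle
  have hb : ∀ t ∈ interior (Icc (0 : ℝ) T), m ≤ deriv g t := fun t ht => by
    have ht' : t ∈ Icc (0 : ℝ) T := interior_subset ht
    rw [hderiv]
    exact hband t (ha.le.trans (hmono ht'.1)) ((hmono ht'.2).trans hle)
  have hgrow := Convex.mul_sub_le_image_sub_of_le_deriv (convex_Icc (0 : ℝ) T)
    hdiff.continuous.continuousOn hdiff.differentiableOn hb 0 (left_mem_Icc.2 hT0) T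
    (right_mem_Icc.2 hT0) hT0
  have h1 : b - a ≤ m * T := by
    have := (div_le_iff₀ hm).1 hT
    linarith
  linarith

/-! ## The plateau cutoff -/

/-- The plateau cutoff is smooth. [folklore] -/
theorem cutoff_contDiff (ε : ℝ) :
    ContDiff ℝ ∞ (fun g : ℝ => Real.smoothTransition ((g - (1 - ε)) / ε) *
      Real.smoothTransition ((1 + 2 * ε - g) / ε)) := by
  refine ContDiff.mul ?_ ?_
  · exact Real.smoothTransition.contDiff.comp ((contDiff_id.sub contDiff_const).div_const ε)
  · exact Real.smoothTransition.contDiff.comp ((contDiff_const.sub contDiff_id).div_const ε)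

/-- The plateau cutoff takes values in `[0, 1]`. [folklore] -/
theorem cutoff_mem_Icc (ε g : ℝ) :
    Real.smoothTransition ((g - (1 - ε)) / ε) * Real.smoothTransition ((1 + 2 * ε - g) / ε) ∈
      Icc (0 : ℝ) 1 :=
  ⟨mul_nonneg (Real.smoothTransition.nonneg _) (Real.smoothTransition.nonneg _),
    mul_le_one₀ (Real.smoothTransition.le_one _) (Real.smoothTransition.nonneg _)
      (Real.smoothTransition.le_one _)⟩

/-- The plateau cutoff is `1` on `[1, 1 + ε]` (`ε > 0`). [folklore] -/
theorem cutoff_eq_one {ε g : ℝ} (hε : 0 < ε) (h1 : 1 ≤ g) (h2 : g ≤ 1 + ε) :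
    Real.smoothTransition ((g - (1 - ε)) / ε) * Real.smoothTransition ((1 + 2 * ε - g) / ε) = 1 := by
  rw [Real.smoothTransition.one_of_one_le, Real.smoothTransition.one_of_one_le, mul_one]
  · rw [le_div_iff₀ hε]; linarith
  · rw [le_div_iff₀ hε]; linarith

/-- Where the plateau cutoff does not vanish, `1 - ε < g < 1 + 2ε` (`ε > 0`). [folklore] -/
theorem cutoff_ne_zero {ε g : ℝ} (hε : 0 < ε)
    (h : Real.smoothTransition ((g - (1 - ε)) / ε) * Real.smoothTransition ((1 + 2 * ε - g) / ε) ≠ 0) :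
    1 - ε < g ∧ g < 1 + 2 * ε := by
  obtain ⟨ha, hb⟩ := mul_ne_zero_iff.1 h
  rw [Ne, Real.smoothTransition.zero_iff_nonpos, not_le] at ha hb
  constructor
  · have := (div_pos_iff_of_pos_right hε).1 ha; linarith
  · have := (div_pos_iff_of_pos_right hε).1 hb; linarith

/-! ## The radial squeeze -/

section Squeeze

variable {E : Type*} [NormedAddCommGroup E] [NormedSpace ℝ E]

/-- **The radial squeeze is continuous in `(λ, y)`**: `S_λ y = y` for `‖y‖ ≤ c` and
`S_λ y = (1 - λ/2 + λ c/(2‖y‖)) y` otherwise (`c > 0`; the two formulas agree on `‖y‖ = c`).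
[folklore] -/
theorem squeeze_continuous {c : ℝ} (hc : 0 < c) :
    Continuous (fun p : ℝ × E => if ‖p.2‖ ≤ c then p.2 else (1 - p.1 / 2 + p.1 * c / (2 * ‖p.2‖)) • p.2) := by
  refine continuous_if_le (continuous_norm.comp continuous_snd) continuous_const
    continuous_snd.continuousOn ?_ ?_
  · refine ContinuousOn.smul ?_ continuous_snd.continuousOn
    refine ((continuous_const.sub (continuous_fst.div_const 2)).continuousOn).add ?_
    refine ContinuousOn.div (continuous_fst.mul continuous_const).continuousOn
      ((continuous_const.mul (continuous_norm.comp continuous_snd)).continuousOn) ?_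
    intro p hp
    have : c ≤ ‖p.2‖ := hp
    exact mul_ne_zero two_ne_zero (hc.trans_le this).ne'
  · rintro ⟨l, y⟩ hy
    simp only at hy ⊢
    rw [hy, show (1 - l / 2 + l * c / (2 * c)) = 1 by field_simp; ring, one_smul]

/-- **Norm of the squeezed point**: for `‖y‖ ≥ c > 0` and `λ ∈ [0, 1]`,
`‖S_λ y‖ = ‖y‖ - λ (‖y‖ - c)/2`, so `c ≤ ‖S_λ y‖ ≤ ‖y‖`. [folklore] -/
theorem norm_squeeze {c l : ℝ} (hc : 0 < c) (hl0 : 0 ≤ l) (hl1 : l ≤ 1) {y : E} (hy : c ≤ ‖y‖) :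
    ‖(1 - l / 2 + l * c / (2 * ‖y‖)) • y‖ = ‖y‖ - l * (‖y‖ - c) / 2 := by
  have hy0 : 0 < ‖y‖ := hc.trans_le hy
  have hcoef : 0 ≤ 1 - l / 2 + l * c / (2 * ‖y‖) := by
    have : 0 ≤ l * c / (2 * ‖y‖) := by positivity
    linarith
  rw [norm_smul, Real.norm_eq_abs, abs_of_nonneg hcoef]
  field_simp
  ring

end Squeeze

end FriendsH2

/-- **Registered helper (HF part 2 of `stub_friendsH2`)**: passing through a band at positive speed (Milnor 1963, proof of Thm. 3.1). [cite: Milnor1963, proof of Thm. 3.1] -/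
theorem helper_friendsH2_band : ∀ (g g' : ℝ → ℝ), (∀ t, HasDerivAt g (g' t) t) → (∀ t, 0 ≤ g' t) → ∀ (a b m T : ℝ), 0 < m → a < g 0 → (∀ t, a ≤ g t → g t ≤ b → m ≤ g' t) → (b - a) / m ≤ T → 0 ≤ T → b < g T := fun _ _ hg hnn _ _ _ _ hm ha hband hT hT0 =>
  FriendsH2.lt_of_hasDerivAt_of_band hg hnn hm ha hband hT hT0

end Summit.SmoothPoincare4.SmoothPoincare4.Theorems.DcrGap.MkFriends

end
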